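import Literature.MathematicalPhysics.QuantumFieldTheory.Balaban1983to89.B13PerturbativeStep
import Literature.MathematicalPhysics.QuantumFieldTheory.Balaban1983to89.B13Resum220
import Literature.MathematicalPhysics.QuantumFieldTheory.Balaban1983to89.B2Lemma25Proof

/-!
# `Balaban1983to89.B13Eq216LatticeSum` — T. Bałaban, *Renormalization group approach to lattice gauge field theories.
II. Cluster expansions*, Commun. Math. Phys. **116** (1988) 1–22 [Balaban1988RG2Cluster]: the LATTICE CONSTANT of the
unit lattice behind the (2.16)-type bounds, `Σ_{b′} e^{−(κ−κ′)|b₋ − b′₋|} = O(1)` — the one hypothesis of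
`B13PerturbativeStep.WRS.of_entrywise` (entrywise decay (2.16) ⇒ weighted row sums at a smaller rate) that that module
lists as *"Still not typed: … the lattice sum Σ_{b′} e^{−(κ−κ′)|b₋−b′₋|} = O(1)"*, discharged from the general
ℤ^ν box-sum `B2Lemma25Proof.sum_exp_neg_l1dist_le` (`Σ_{x′∈S} e^{−b|x−x′|₁} ≤ (1 + 2/b)^ν` for every finite S ⊂ ℤ^ν).

statement-level skeleton of published theorems with citation tags; proofs where landed; nothing here is a claim about the Yang–Mills mass gap

Print, p. 16: (2.16) *"with matrix elements satisfying the bound |R₁(b,b′)| ≤ (O(1)δ₀^{−1/3}M⁻¹ + O(α₀ + α₁))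
exp(−δ₀|b₋ − b′₋|)"* — an ENTRYWISE decay in the distance of the lower endpoints b₋, b′₋ of two bonds of the unit
lattice; and, after (2.19): *"We use the first exponential factor in (2.19) to bound the sum, and this yields a constant
O(1)."*  The typed row-sum form `B13PerturbativeStep.WRS κ′ d A ρ` (Σ_j ‖A i j‖e^{κ′d(i,j)} ≤ ρ) follows from the
entrywise form at any smaller rate κ′ < κ given the lattice constant; here the constant is made explicit for index
sets LOCATED on ℤ^ν with bounded fibres (`sum_exp_neg_l1dist_loc_le`: ≤ m(1 + 2/b)^ν when at most m indices sit at
each site), in particular for bonds indexed by (lower endpoint, direction) ∈ S × Fin ν (`card_fiber_bond_le`: m = ν),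
giving `WRS.of_entrywise_loc` and `WRS.of_entrywise_bonds` (§1, ℓ¹ distance `B2Lemma25Proof.l1dist`); §2 (v1.1) the same
in the tree's other typed distance, the sup metric of `B13ScaleTransfer.Pt d`, through `B13Resum220.rowSum_exp_dist_le` /
`B6KernelComposition.latticeConst` (`WRS.of_entrywise_site`, `WRS.of_entrywise_site_explicit` with the explicit
(2(1 + d/(κ−κ′)))^d of `B13Resum220.latticeConst_le`); §3 (v1.1) the other two inputs of the consumers of the typed
(2.16) (`B13Replacement223.abs_quadForm_le_of_WRS` / `hR1_of_WRS` / `hR2_of_WRS`): the weight hypotheses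
`weightHyp_l1dist` / `weightHyp_dist` and the transposed bounds `WRS.of_entrywise_loc_transpose` /
`_bonds_transpose` / `_site_transpose` — so all three run from the PRINTED entrywise (2.16).  Elementary; 0 sorry; no
new definitions or facts.
-/

namespace Literature.MathematicalPhysics.QuantumFieldTheory.Balaban1983to89.B13Eq216LatticeSum

open Literature.MathematicalPhysics.QuantumFieldTheory.Balaban1983to89
open Literature.MathematicalPhysics.QuantumFieldTheory.Balaban1983to89.B2Lemma25Proof
  (l1dist l1dist_nonneg l1dist_comm sum_exp_neg_l1dist_le)
open Literature.MathematicalPhysics.QuantumFieldTheory.Balaban1983to89.B13PerturbativeStep (WRS)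

noncomputable section

variable {ν : ℕ} {n : Type*} [Fintype n]

/-- **The lattice constant for an index set located on ℤ^ν.**  If `loc : n → ℤ^ν` places at most `m` indices at each
site, then for every index `i` and rate `b > 0`, `Σ_j e^{−b|loc i − loc j|₁} ≤ m·(1 + 2/b)^ν` (group the sum by sites
and apply `B2Lemma25Proof.sum_exp_neg_l1dist_le` to the finite set of occupied sites) — the printed
*"Σ_{b′} e^{−(κ−κ′)|b₋ − b′₋|} = O(1)"* with an explicit O(1). [cite: Balaban1988RG2Cluster, (2.16) p.16 and the resummation after (2.19) p.16 ("this yields a constant O(1)")] -/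
theorem sum_exp_neg_l1dist_loc_le {b : ℝ} (hb : 0 < b) (loc : n → (Fin ν → ℤ)) {m : ℕ}
    (hfib : ∀ x : Fin ν → ℤ, (Finset.univ.filter fun j => loc j = x).card ≤ m) (i : n) :
    ∑ j, Real.exp (-(b * l1dist (loc i) (loc j))) ≤ m * (1 + 2 / b) ^ ν := by
  classical
  have hfw := Finset.sum_fiberwise_of_maps_to (s := (Finset.univ : Finset n)) (t := Finset.univ.image loc)
    (g := loc) (fun j hj => Finset.mem_image_of_mem loc hj) (fun j => Real.exp (-(b * l1dist (loc i) (loc j))))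
  rw [← hfw]
  calc ∑ x ∈ Finset.univ.image loc, ∑ j ∈ Finset.univ.filter (fun j => loc j = x),
        Real.exp (-(b * l1dist (loc i) (loc j)))
      = ∑ x ∈ Finset.univ.image loc,
          ((Finset.univ.filter fun j => loc j = x).card : ℝ) * Real.exp (-(b * l1dist (loc i) x)) := by
        refine Finset.sum_congr rfl fun x _ => ?_
        have hc : ∀ j ∈ Finset.univ.filter (fun j => loc j = x),
            Real.exp (-(b * l1dist (loc i) (loc j))) = Real.exp (-(b * l1dist (loc i) x)) := fun j hj => by
          rw [(Finset.mem_filter.1 hj).2]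
        rw [Finset.sum_congr rfl hc, Finset.sum_const, nsmul_eq_mul]
    _ ≤ ∑ x ∈ Finset.univ.image loc, (m : ℝ) * Real.exp (-(b * l1dist (loc i) x)) :=
        Finset.sum_le_sum fun x _ => mul_le_mul_of_nonneg_right (by exact_mod_cast hfib x) (Real.exp_pos _).le
    _ = m * ∑ x ∈ Finset.univ.image loc, Real.exp (-(b * l1dist (loc i) x)) := by rw [Finset.mul_sum]
    _ ≤ m * (1 + 2 / b) ^ ν :=
        mul_le_mul_of_nonneg_left (sum_exp_neg_l1dist_le hb (loc i) _) (Nat.cast_nonneg m)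

/-- **Bonds of the unit lattice have fibres of size ≤ ν over their lower endpoints**: indexing the bonds with lower
endpoint in a finite `S ⊂ ℤ^ν` by (b₋, direction) ∈ S × Fin ν, at most ν of them sit at each site. [cite: Balaban1988RG2Cluster, (2.16) p.16 (bonds b, b′ located by b₋, b′₋)] -/
theorem card_fiber_bond_le (S : Finset (Fin ν → ℤ)) (x : Fin ν → ℤ) :
    (Finset.univ.filter fun j : S × Fin ν => ((j.1 : Fin ν → ℤ)) = x).card ≤ ν := by
  classical
  calc (Finset.univ.filter fun j : S × Fin ν => ((j.1 : Fin ν → ℤ)) = x).card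
      ≤ (Finset.univ : Finset (Fin ν)).card :=
        Finset.card_le_card_of_injOn Prod.snd (fun _ _ => Finset.mem_coe.2 (Finset.mem_univ _))
          (fun j hj j' hj' h => by
            have h1 : ((j.1 : Fin ν → ℤ)) = x := (Finset.mem_filter.1 (Finset.mem_coe.1 hj)).2
            have h2 : ((j'.1 : Fin ν → ℤ)) = x := (Finset.mem_filter.1 (Finset.mem_coe.1 hj')).2
            exact Prod.ext (Subtype.ext (h1.trans h2.symm)) h)
    _ = ν := by simp

variable {𝕜 : Type*} [RCLike 𝕜]

/-- **Entrywise decay ⇒ weighted row sums, with the lattice constant discharged** (index set located on ℤ^ν with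
fibres ≤ m): `‖A i j‖ ≤ θ e^{−κ|loc i − loc j|₁}` and κ′ < κ ⇒ `WRS κ′ |·−·|₁ A (θ·m·(1 + 2/(κ−κ′))^ν)` —
`B13PerturbativeStep.WRS.of_entrywise` with its hypothesis `hL` supplied by `sum_exp_neg_l1dist_loc_le`. [cite: Balaban1988RG2Cluster, (2.16) p.16 and p.16 after (2.19)] -/
theorem WRS.of_entrywise_loc {A : Matrix n n 𝕜} {θ κ κ' : ℝ} (hθ : 0 ≤ θ) (hκ : κ' < κ)
    (loc : n → (Fin ν → ℤ)) {m : ℕ} (hfib : ∀ x : Fin ν → ℤ, (Finset.univ.filter fun j => loc j = x).card ≤ m)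
    (hA : ∀ i j, ‖A i j‖ ≤ θ * Real.exp (-(κ * l1dist (loc i) (loc j)))) :
    WRS κ' (fun i j => l1dist (loc i) (loc j)) A (θ * (m * (1 + 2 / (κ - κ')) ^ ν)) :=
  B13PerturbativeStep.WRS.of_entrywise hθ hA fun i => sum_exp_neg_l1dist_loc_le (sub_pos.2 hκ) loc hfib i

/-- **The printed instance: kernels indexed by bonds of the unit lattice** ((2.16): b, b′ with lower endpoints b₋, b′₋
in a finite `S ⊂ ℤ^ν`, indexed by (b₋, direction)): `|A(b,b′)| ≤ θ e^{−κ|b₋ − b′₋|₁}` and κ′ < κ ⇒ the row-sum form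
`WRS κ′ |b₋ − b′₋|₁ A (θ·ν·(1 + 2/(κ−κ′))^ν)`. [cite: Balaban1988RG2Cluster, (2.16) p.16 and p.16 after (2.19) ("this yields a constant O(1)")] -/
theorem WRS.of_entrywise_bonds (S : Finset (Fin ν → ℤ)) {A : Matrix (S × Fin ν) (S × Fin ν) 𝕜} {θ κ κ' : ℝ}
    (hθ : 0 ≤ θ) (hκ : κ' < κ)
    (hA : ∀ b b' : S × Fin ν, ‖A b b'‖ ≤ θ * Real.exp (-(κ * l1dist (b.1 : Fin ν → ℤ) (b'.1 : Fin ν → ℤ)))) :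
    WRS κ' (fun b b' : S × Fin ν => l1dist (b.1 : Fin ν → ℤ) (b'.1 : Fin ν → ℤ)) A
      (θ * (ν * (1 + 2 / (κ - κ')) ^ ν)) :=
  WRS.of_entrywise_loc hθ hκ (fun b : S × Fin ν => (b.1 : Fin ν → ℤ)) (card_fiber_bond_le S) hA

/-! ## §2 (v1.1). The same lattice constant in the SUP METRIC of `B13ScaleTransfer.Pt d` — the distance of the
(2.19) ⇒ (2.20) resummation `B13Resum220` (`rowSum_exp_dist_le`, constant `B6KernelComposition.latticeConst`) -/

section SupMetric

open Literature.MathematicalPhysics.QuantumFieldTheory.Balaban1983to89.B13ScaleTransfer (Pt)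
open Literature.MathematicalPhysics.QuantumFieldTheory.Balaban1983to89.B6KernelComposition (latticeConst)
open Literature.MathematicalPhysics.QuantumFieldTheory.Balaban1983to89.B13Resum220 (rowSum_exp_dist_le latticeConst_le)

/-- **Entrywise decay ⇒ weighted row sums in the sup metric of ℤ^d**, lattice constant discharged by
`B13Resum220.rowSum_exp_dist_le`: `‖A i j‖ ≤ θ e^{−κ|site i − site j|_∞}`, at most `m` indices per site, κ′ < κ ⇒
`WRS κ′ |·−·|_∞ A (θ·m·C(d, κ−κ′))`, `C = B6KernelComposition.latticeConst`. [cite: Balaban1988RG2Cluster, (2.16) p.16 and p.16 after (2.19) ("this yields a constant O(1)")] -/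
theorem WRS.of_entrywise_site {d : ℕ} {A : Matrix n n 𝕜} {θ κ κ' : ℝ} (hθ : 0 ≤ θ) (hκ : κ' < κ)
    (site : n → Pt d) {m : ℕ} (hfib : ∀ z : Pt d, (Finset.univ.filter fun j => site j = z).card ≤ m)
    (hA : ∀ i j, ‖A i j‖ ≤ θ * Real.exp (-(κ * dist (site i) (site j)))) :
    WRS κ' (fun i j => dist (site i) (site j)) A (θ * (m * latticeConst d (κ - κ'))) :=
  B13PerturbativeStep.WRS.of_entrywise hθ hA fun i => by
    convert rowSum_exp_dist_le Finset.univ site (m := m) (fun z => by convert hfib z) (sub_pos.2 hκ) (site i)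
      using 1

/-- … with the explicit constant `C(d, a) ≤ (2(1 + d/a))^d` of `B13Resum220.latticeConst_le`:
`WRS κ′ |·−·|_∞ A (θ·m·(2(1 + d/(κ−κ′)))^d)`. [cite: Balaban1988RG2Cluster, (2.16) p.16 and p.16 after (2.19)] -/
theorem WRS.of_entrywise_site_explicit {d : ℕ} {A : Matrix n n 𝕜} {θ κ κ' : ℝ} (hθ : 0 ≤ θ) (hκ : κ' < κ)
    (site : n → Pt d) {m : ℕ} (hfib : ∀ z : Pt d, (Finset.univ.filter fun j => site j = z).card ≤ m)
    (hA : ∀ i j, ‖A i j‖ ≤ θ * Real.exp (-(κ * dist (site i) (site j)))) :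
    WRS κ' (fun i j => dist (site i) (site j)) A (θ * (m * (2 * (1 + d / (κ - κ'))) ^ d)) :=
  (WRS.of_entrywise_site hθ hκ site hfib hA).mono
    (mul_le_mul_of_nonneg_left (mul_le_mul_of_nonneg_left (latticeConst_le d (sub_pos.2 hκ)) (Nat.cast_nonneg m)) hθ)

end SupMetric

/-! ## §3 (v1.1). The weight hypotheses and the transposed bound — the three inputs (`WeightHyp κ′ d`, `WRS κ′ d R θ′`,
`WRS κ′ d Rᵀ θ′`) under which the consumers of (2.16) in its typed row-sum form (`B13PerturbativeStep.norm_bilinForm_le_of_WRS`,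
`B13Replacement223.abs_quadForm_le_of_WRS` / `hR1_of_WRS` / `hR2_of_WRS`) run, all three from the PRINTED entrywise (2.16) -/

section Inputs

open scoped Matrix
open Literature.MathematicalPhysics.QuantumFieldTheory.Balaban1983to89.B13PerturbativeStep (WeightHyp)
open Literature.MathematicalPhysics.QuantumFieldTheory.Balaban1983to89.B6KernelComposition (latticeConst)
open Literature.MathematicalPhysics.QuantumFieldTheory.Balaban1983to89.B13ScaleTransfer (Pt)

omit [Fintype n] in
/-- `|x − x|₁ = 0`; private plumbing. [folklore] -/
private theorem l1dist_self (x : Fin ν → ℤ) : l1dist x x = 0 := by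
  simp [l1dist]

omit [Fintype n] in
/-- The triangle inequality for `|·−·|₁` on ℤ^ν; private plumbing. [folklore] -/
private theorem l1dist_triangle (x y z : Fin ν → ℤ) : l1dist x z ≤ l1dist x y + l1dist y z := by
  unfold l1dist
  rw [← Finset.sum_add_distrib]
  refine Finset.sum_le_sum fun i _ => ?_
  have h : ((x i - z i : ℤ) : ℝ) = ((x i - y i : ℤ) : ℝ) + ((y i - z i : ℤ) : ℝ) := by push_cast; ring
  rw [h]
  exact abs_add_le _ _

omit [Fintype n] in
/-- **The ℓ¹ distance of located indices is an admissible weight** (`B13PerturbativeStep.WeightHyp`: κ′ ≥ 0, d(i,i) = 0,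
d ≥ 0, triangle inequality) — so the algebra of (2.16)-type bounds (`WRS.mul`, `WRS.inv_one_sub`, `norm_bilinForm_le_of_WRS`)
applies to kernels indexed by bonds/sites of the unit lattice. [cite: Balaban1988RG2Cluster, (2.16) p.16 (the weight e^{−δ₀|b₋−b′₋|})] -/
theorem weightHyp_l1dist {κ' : ℝ} (hκ' : 0 ≤ κ') (loc : n → (Fin ν → ℤ)) :
    WeightHyp κ' (fun i j => l1dist (loc i) (loc j)) where
  κ_nonneg := hκ'
  zero i := l1dist_self (loc i)
  nonneg i j := l1dist_nonneg (loc i) (loc j)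
  tri i j k := l1dist_triangle (loc i) (loc j) (loc k)

omit [Fintype n] in
/-- **The sup metric of ℤ^d on located indices is an admissible weight.** [cite: Balaban1988RG2Cluster, (2.16) p.16 (the weight e^{−δ₀|b₋−b′₋|})] -/
theorem weightHyp_dist {d : ℕ} {κ' : ℝ} (hκ' : 0 ≤ κ') (site : n → Pt d) :
    WeightHyp κ' (fun i j => dist (site i) (site j)) where
  κ_nonneg := hκ'
  zero i := dist_self (site i)
  nonneg _ _ := dist_nonneg
  tri i j k := dist_triangle (site i) (site j) (site k)

omit [Fintype n] in
/-- An entrywise bound symmetric in the distance passes to the transpose; private plumbing. [folklore] -/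
private theorem entrywise_transpose {A : Matrix n n 𝕜} {θ κ : ℝ} {dd : n → n → ℝ} (hsymm : ∀ i j, dd i j = dd j i)
    (hA : ∀ i j, ‖A i j‖ ≤ θ * Real.exp (-(κ * dd i j))) :
    ∀ i j, ‖Aᵀ i j‖ ≤ θ * Real.exp (-(κ * dd i j)) := fun i j => by
  rw [Matrix.transpose_apply, hsymm i j]
  exact hA j i

/-- **The transposed kernel obeys the same row-sum bound** (the printed (2.16) is symmetric in b, b′ through
|b₋ − b′₋|): entrywise decay of `A` ⇒ `WRS κ′ |·−·|₁ Aᵀ (θ·m·(1 + 2/(κ−κ′))^ν)` — the `Rᵀ` input of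
`B13Replacement223.abs_quadForm_le_of_WRS` / `hR1_of_WRS` / `hR2_of_WRS`. [cite: Balaban1988RG2Cluster, (2.16) p.16, (2.21) p.16] -/
theorem WRS.of_entrywise_loc_transpose {A : Matrix n n 𝕜} {θ κ κ' : ℝ} (hθ : 0 ≤ θ) (hκ : κ' < κ)
    (loc : n → (Fin ν → ℤ)) {m : ℕ} (hfib : ∀ x : Fin ν → ℤ, (Finset.univ.filter fun j => loc j = x).card ≤ m)
    (hA : ∀ i j, ‖A i j‖ ≤ θ * Real.exp (-(κ * l1dist (loc i) (loc j)))) :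
    WRS κ' (fun i j => l1dist (loc i) (loc j)) Aᵀ (θ * (m * (1 + 2 / (κ - κ')) ^ ν)) :=
  WRS.of_entrywise_loc hθ hκ loc hfib (entrywise_transpose (fun i j => l1dist_comm (loc i) (loc j)) hA)

/-- … and for bonds of the unit lattice indexed by (b₋, direction). [cite: Balaban1988RG2Cluster, (2.16) p.16, (2.21) p.16] -/
theorem WRS.of_entrywise_bonds_transpose (S : Finset (Fin ν → ℤ)) {A : Matrix (S × Fin ν) (S × Fin ν) 𝕜}
    {θ κ κ' : ℝ} (hθ : 0 ≤ θ) (hκ : κ' < κ)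
    (hA : ∀ b b' : S × Fin ν, ‖A b b'‖ ≤ θ * Real.exp (-(κ * l1dist (b.1 : Fin ν → ℤ) (b'.1 : Fin ν → ℤ)))) :
    WRS κ' (fun b b' : S × Fin ν => l1dist (b.1 : Fin ν → ℤ) (b'.1 : Fin ν → ℤ)) Aᵀ
      (θ * (ν * (1 + 2 / (κ - κ')) ^ ν)) :=
  WRS.of_entrywise_loc_transpose hθ hκ (fun b : S × Fin ν => (b.1 : Fin ν → ℤ)) (card_fiber_bond_le S) hA

/-- … and in the sup metric. [cite: Balaban1988RG2Cluster, (2.16) p.16, (2.21) p.16] -/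
theorem WRS.of_entrywise_site_transpose {d : ℕ} {A : Matrix n n 𝕜} {θ κ κ' : ℝ} (hθ : 0 ≤ θ) (hκ : κ' < κ)
    (site : n → Pt d) {m : ℕ} (hfib : ∀ z : Pt d, (Finset.univ.filter fun j => site j = z).card ≤ m)
    (hA : ∀ i j, ‖A i j‖ ≤ θ * Real.exp (-(κ * dist (site i) (site j)))) :
    WRS κ' (fun i j => dist (site i) (site j)) Aᵀ (θ * (m * latticeConst d (κ - κ'))) :=
  WRS.of_entrywise_site hθ hκ site hfib (entrywise_transpose (fun i j => dist_comm (site i) (site j)) hA)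

end Inputs

end

end Literature.MathematicalPhysics.QuantumFieldTheory.Balaban1983to89.B13Eq216LatticeSum
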